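import Summits.FinalStateConjecture.FinalStateConjecture.Theorems.SwallowTheDatumSubdataDevelopmentsEmbedDoDLocal
import Summits.FinalStateConjecture.FinalStateConjecture.Theorems.SwallowTheDatumSubdataDevelopmentsEmbedDoDCone

/-!
# Route SwallowTheDatum · item `SubdataDevelopmentsEmbed` (stmt-FinalStateConjecture-10053) —
# towards the domain of dependence of the sub-datum (`hcauchy`), VII: the LOCAL
# DOMAIN-OF-DEPENDENCE LEMMA at a point of a Cauchy hypersurface with a tangency estimate

`localDoD_of_tangency`: let `Σ` be a Cauchy hypersurface, `p ∈ Σ`, `W ∈ T_p M` future timelike,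
and suppose the tangency hypothesis of `…DoDLocal.lean` (in the chart `φ` at `p`, `Σ` is tangent
at `p` to the kernel of `m = Ĝ_{φ p}(Ŵ, ·)`) and that `S ⊆ Σ` contains all points of `Σ` which
are close to `p` in the chart. Then `p` has a neighbourhood `O` such that every endless timelike
curve through a point of `O` meets `S` — i.e. `O` lies in the domain of dependence of `S`, the
hypothesis `hL` of the soft assembly `exists_opens_isCauchyHypersurface_of_localDoD'`
(`…DoDAssembly.lean`).

Proof. Let `γ` be endless timelike with `γ t₀ = q ∈ O` and let `t*` be its unique crossing of
`Σ`; say `t* ≤ t₀`. CLAIM: `γ([t*, t₀])` stays in the coordinate ball `B(φ p, ρ)`; then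
`γ t* ∈ Σ ∩ φ⁻¹ B(φ p, ρ) ⊆ S`. The claim is proved by continuous induction downwards from `t₀`
(`Icc_induction_down`): as long as `γ([t, t₀]) ⊆ B(φ p, ρ)`, the cone estimate
(`cone_curve_estimate` with the uniform cone bound `exists_cone_bound` of `…DoDCone.lean`) gives
`c ‖φ γ t₀ - φ γ r‖ ≤ m(φ γ r) - m(φ γ t₀)`, and the one-sided bound `exists_osb` at the point
`γ r ∈ I⁺(Σ) ∪ Σ` gives `m(φ γ r - φ p) ≤ (c/8) ρ`; with `‖φ q - φ p‖ < ρ' ≪ ρ` this improves the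
bound to `‖φ γ r - φ p‖ ≤ 3ρ/8`, which passes to the limit `r ↓ t` through the compact set
`φ⁻¹(closedBall(φ p, 3ρ/8))`. The case `t₀ ≤ t*` is the mirror image (`Icc_induction_up`, the
other one-sided bound). This is the elementary local geometry behind O'Neill 1983, Ch. 14,
Lemma 14.43 / Hawking–Ellis 1973, Prop. 6.6.6 (openness of the domain of dependence near an
acausal spacelike hypersurface), carried out in a chart. No definition, no named fact.
-/

noncomputable section

open Function Set Filter Topology TopologicalSpace Bundle Manifold
open scoped Manifold ContDiff Topology

namespace Summit.FinalStateConjecture.FinalStateConjecture.Theorems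

namespace SubdataDevelopmentsEmbed

open Literature.Geometry.Lorentzian

section Main

variable {E : Type*} [NormedAddCommGroup E] [NormedSpace ℝ E] {H : Type*} [TopologicalSpace H]
  {I : ModelWithCorners ℝ E H} {n : ℕ∞ω} {M : Type*} [TopologicalSpace M] [ChartedSpace H M]
  [IsManifold I ∞ M] {g : LorentzianMetric I n M} {τ : TimeOrientation g}
  [T2Space M] [SecondCountableTopology M] [BoundarylessManifold I M] [FiniteDimensional ℝ E]

/-- **The local domain-of-dependence lemma** (see the module docstring). With `φ` the chart at
`p ∈ Σ`, `Ŵ` the coordinate image of the future timelike vector `W ∈ T_p M` and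
`m = Ĝ_{φ p}(Ŵ, ·)`: if `|m(φ q - φ p)| ≤ ε ‖φ q - φ p‖` on `Σ` near `p` for every `ε > 0`, and
`S ⊆ Σ` contains the points of `Σ` near `p`, then every endless timelike curve through a point of
some neighbourhood of `p` meets `S`. -/
theorem localDoD_of_tangency (hn : 2 ≤ n) {Sig S : Set M} (hSig : g.IsCauchyHypersurface τ Sig)
    {p : M} (hp : p ∈ Sig) {W : TangentSpace I p} (hW : g.IsTimelike W)
    (hWf : τ.IsFutureDirected W)
    (hT : ∀ ε : ℝ, 0 < ε → ∃ δ > 0, ∀ q ∈ Sig, q ∈ (chartAt H p).source →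
      ‖extChartAt I p q - extChartAt I p p‖ < δ →
      |g.coordMetric p (extChartAt I p p)
          ((trivializationAt E (TangentSpace I) p).continuousLinearMapAt ℝ p W)
          (extChartAt I p q - extChartAt I p p)| ≤ ε * ‖extChartAt I p q - extChartAt I p p‖)
    (hS : ∃ δ > 0, ∀ q ∈ Sig, q ∈ (chartAt H p).source →
      ‖extChartAt I p q - extChartAt I p p‖ < δ → q ∈ S) :
    ∃ O ∈ 𝓝 p, ∀ q ∈ O, ∀ (γ : ℝ → M) (u : Set ℝ), g.IsEndlessTimelikeCurve τ γ u →
      ∀ t ∈ u, γ t = q → ∃ t' ∈ u, γ t' ∈ S := by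
  have hn1 : (1 : ℕ∞ω) ≤ n := le_trans one_le_two hn
  -- the uniform cone bound and the one-sided bounds at scale `ε = c / 8`
  obtain ⟨c, hc, rcb, hrcb, hball, hcone⟩ := exists_cone_bound (τ := τ) hn1 p hW hWf
  have hε : 0 < c / 8 := by positivity
  obtain ⟨ρ₀, hρ₀, hosb⟩ := exists_osb hn hSig hp hW hWf hT hε
  obtain ⟨δS, hδS, hS'⟩ := hS
  set x₀ : E := extChartAt I p p with hx₀def
  set eT := trivializationAt E (TangentSpace I) p with heT
  set W₀ : E := eT.continuousLinearMapAt ℝ p W with hW₀def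
  set m : E →L[ℝ] ℝ := g.coordMetric p x₀ W₀ with hmdef
  -- the radii `ρ` (good ball) and `ρ'` (the neighbourhood `O`)
  set ρ : ℝ := min (min ρ₀ rcb) δS with hρdef
  have hρ : 0 < ρ := lt_min (lt_min hρ₀ hrcb) hδS
  have hρρ₀ : ρ ≤ ρ₀ := (min_le_left _ _).trans (min_le_left _ _)
  have hρrcb : ρ ≤ rcb := (min_le_left _ _).trans (min_le_right _ _)
  have hρδS : ρ ≤ δS := min_le_right _ _
  set ρ' : ℝ := min (ρ / 8) (c * ρ / (8 * (‖m‖ + 1))) with hρ'def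
  have hρ' : 0 < ρ' := lt_min (by positivity) (by positivity)
  have hρ'1 : ρ' ≤ ρ / 8 := min_le_left _ _
  have hρ'2 : ‖m‖ * ρ' ≤ c * ρ / 8 := by
    have h1 : ρ' ≤ c * ρ / (8 * (‖m‖ + 1)) := min_le_right _ _
    have h2 : ‖m‖ * (c * ρ / (8 * (‖m‖ + 1))) ≤ c * ρ / 8 := by
      rw [mul_div_assoc', div_le_iff₀ (by positivity)]
      nlinarith [norm_nonneg m, mul_pos hc hρ]
    exact (mul_le_mul_of_nonneg_left h1 (norm_nonneg _)).trans h2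
  -- coordinate balls pulled back to the chart domain are open
  have hopen_of : ∀ r : ℝ,
      IsOpen {y : M | y ∈ (chartAt H p).source ∧ ‖extChartAt I p y - x₀‖ < r} := by
    intro r
    have h := (continuousOn_extChartAt (I := I) p).isOpen_inter_preimage
      (isOpen_extChartAt_source (I := I) p) (Metric.isOpen_ball (x := x₀) (ε := r))
    rw [extChartAt_source] at h
    convert h using 1
    ext y
    simp only [mem_setOf_eq, mem_inter_iff, mem_preimage, Metric.mem_ball, dist_eq_norm]
  -- the neighbourhood `O`
  refine ⟨{y : M | y ∈ (chartAt H p).source ∧ ‖extChartAt I p y - x₀‖ < ρ'},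
    (hopen_of ρ').mem_nhds ⟨mem_chart_source H p, by rw [hx₀def, sub_self, norm_zero]; exact hρ'⟩,
    fun q hq γ u hγ t₀ ht₀ hγt₀ ↦ ?_⟩
  obtain ⟨ts, ⟨htsu, htsSig⟩, -⟩ := hSig γ u hγ
  have huoc : u.OrdConnected := hγ.1
  have hftc : g.IsFutureTimelikeCurveOn τ γ u := hγ.2.1
  -- it suffices that `γ t*` is a good point
  suffices hgood : γ ts ∈ (chartAt H p).source ∧ ‖extChartAt I p (γ ts) - x₀‖ < ρ from
    ⟨ts, htsu, hS' _ htsSig hgood.1 (lt_of_lt_of_le hgood.2 hρδS)⟩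
  -- tools
  have hcont : ∀ r ∈ u, ContinuousAt γ r := fun r hr ↦ (hftc r hr).1.continuousAt
  have hopen : ∀ r ∈ u, (γ r ∈ (chartAt H p).source ∧ ‖extChartAt I p (γ r) - x₀‖ < ρ) →
      ∀ᶠ r' in 𝓝 r, γ r' ∈ (chartAt H p).source ∧ ‖extChartAt I p (γ r') - x₀‖ < ρ :=
    fun r hr h ↦ (hcont r hr).preimage_mem_nhds ((hopen_of ρ).mem_nhds h)
  have hq0 : γ t₀ ∈ (chartAt H p).source ∧ ‖extChartAt I p (γ t₀) - x₀‖ < ρ' := by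
    rw [hγt₀]; exact hq
  have hgood0 : γ t₀ ∈ (chartAt H p).source ∧ ‖extChartAt I p (γ t₀) - x₀‖ < ρ :=
    ⟨hq0.1, lt_of_lt_of_le hq0.2 (hρ'1.trans (by linarith))⟩
  -- the compact set `K = φ⁻¹(closedBall x₀ (3ρ/8))`
  set K : Set M := (extChartAt I p).symm '' Metric.closedBall x₀ (3 * ρ / 8) with hKdef
  have hKsub : Metric.closedBall x₀ (3 * ρ / 8) ⊆ (extChartAt I p).target := fun z hz ↦
    hball (Metric.mem_ball.mpr (lt_of_le_of_lt (Metric.mem_closedBall.mp hz) (by linarith)))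
  have hKc : IsClosed K :=
    ((isCompact_closedBall x₀ _).image_of_continuousOn
      ((continuousOn_extChartAt_symm p).mono hKsub)).isClosed
  have hKgood : ∀ y ∈ K, y ∈ (chartAt H p).source ∧ ‖extChartAt I p y - x₀‖ < ρ := by
    rintro y ⟨z, hz, rfl⟩
    have hzt := hKsub hz
    refine ⟨?_, ?_⟩
    · rw [← extChartAt_source I]
      exact (extChartAt I p).map_target hzt
    · rw [(extChartAt I p).right_inv hzt]
      have : ‖z - x₀‖ ≤ 3 * ρ / 8 := by rw [← dist_eq_norm]; exact Metric.mem_closedBall.mp hz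
      linarith
  have hmemK : ∀ y ∈ (chartAt H p).source, ‖extChartAt I p y - x₀‖ ≤ 3 * ρ / 8 → y ∈ K := by
    intro y hy hyn
    refine ⟨extChartAt I p y, Metric.mem_closedBall.mpr (by rwa [dist_eq_norm]), ?_⟩
    exact (extChartAt I p).left_inv (by rw [extChartAt_source]; exact hy)
  -- the chart derivative of `γ` and the cone bound at good parameters
  have hderiv : ∀ r ∈ u, γ r ∈ (chartAt H p).source →
      HasDerivAt (extChartAt I p ∘ γ) (eT.continuousLinearMapAt ℝ (γ r) (velocity I γ r)) r :=
    fun r hr hsrc ↦ hasDerivAt_extChartAt_comp_continuousLinearMapAt (hftc r hr).1 hsrc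
  have hconeγ : ∀ r ∈ u, γ r ∈ (chartAt H p).source → ‖extChartAt I p (γ r) - x₀‖ < ρ →
      c * ‖eT.continuousLinearMapAt ℝ (γ r) (velocity I γ r)‖ ≤
        (-m) (eT.continuousLinearMapAt ℝ (γ r) (velocity I γ r)) := by
    intro r hr hsrc hnorm
    rw [neg_apply]
    exact hcone (γ r) hsrc (lt_of_lt_of_le hnorm hρrcb) _ (hftc r hr).2.1 (hftc r hr).2.2
  -- `|m(φ γ t₀ - x₀)| ≤ ‖m‖ ρ' ≤ c ρ / 8`
  have hmt₀ : |m (extChartAt I p (γ t₀) - x₀)| ≤ ‖m‖ * ρ' := by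
    rw [← Real.norm_eq_abs]
    exact (m.le_opNorm _).trans (mul_le_mul_of_nonneg_left hq0.2.le (norm_nonneg _))
  rcases le_total ts t₀ with hts | hts
  · -- Case A: the crossing is not later than `t₀`; continuous induction downwards on `[t*, t₀]`
    have hsub : Icc ts t₀ ⊆ u := huoc.out htsu ht₀
    have hKS : ∀ r ∈ Ioc ts t₀, (∀ r' ∈ Icc r t₀, γ r' ∈ (chartAt H p).source ∧
        ‖extChartAt I p (γ r') - x₀‖ < ρ) → ‖extChartAt I p (γ r) - x₀‖ ≤ 3 * ρ / 8 := by
      intro r hr hseg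
      have hJ : ∀ r' ∈ Icc r t₀, r' ∈ u := fun r' hr' ↦ hsub ⟨hr.1.le.trans hr'.1, hr'.2⟩
      have hrr : r ∈ Icc r t₀ := left_mem_Icc.mpr hr.2
      obtain ⟨-, hest⟩ := cone_curve_estimate (-m) hc (ordConnected_Icc (a := r) (b := t₀))
        (σ' := fun r' ↦ eT.continuousLinearMapAt ℝ (γ r') (velocity I γ r'))
        (fun r' hr' ↦ hderiv r' (hJ r' hr') (hseg r' hr').1)
        (fun r' hr' ↦ hconeγ r' (hJ r' hr') (hseg r' hr').1 (hseg r' hr').2)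
        hrr (right_mem_Icc.mpr hr.2) hr.2
      have hest' : c * ‖extChartAt I p (γ t₀) - extChartAt I p (γ r)‖ ≤
          m (extChartAt I p (γ r)) - m (extChartAt I p (γ t₀)) := by
        have := hest
        simp only [comp_apply, neg_apply] at this
        linarith
      -- `γ r ∉ I⁻(Σ)` since `r > t*`
      have hrI : γ r ∉ g.chronologicalPast τ Sig :=
        not_mem_chronologicalPast_of_mem_chronologicalFuture hn hSig
          (mem_chronologicalFuture_of_lt huoc hftc htsu (hJ r hrr) hr.1 htsSig)
      have hosb1 := (hosb ρ hρρ₀ (γ r) (hseg r hrr).1 (hseg r hrr).2).1 hrI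
      have hA : -(m (extChartAt I p (γ t₀) - x₀)) ≤ ‖m‖ * ρ' := (neg_le_abs _).trans hmt₀
      have e1 := m.map_sub (extChartAt I p (γ r)) x₀
      have e2 := m.map_sub (extChartAt I p (γ t₀)) x₀
      have h2 : c * ‖extChartAt I p (γ t₀) - extChartAt I p (γ r)‖ ≤ c * (ρ / 4) := by
        linarith
      have h3 : ‖extChartAt I p (γ t₀) - extChartAt I p (γ r)‖ ≤ ρ / 4 :=
        le_of_mul_le_mul_left h2 hc
      calc ‖extChartAt I p (γ r) - x₀‖
          = ‖(extChartAt I p (γ r) - extChartAt I p (γ t₀)) + (extChartAt I p (γ t₀) - x₀)‖ := by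
            abel_nf
        _ ≤ ‖extChartAt I p (γ r) - extChartAt I p (γ t₀)‖ + ‖extChartAt I p (γ t₀) - x₀‖ :=
            norm_add_le _ _
        _ ≤ ρ / 4 + ρ' := add_le_add (by rw [norm_sub_rev]; exact h3) hq0.2.le
        _ ≤ 3 * ρ / 8 := by linarith
    refine Icc_induction_down (P := fun r ↦ γ r ∈ (chartAt H p).source ∧
        ‖extChartAt I p (γ r) - x₀‖ < ρ) (fun r hr h ↦ hopen r (hsub hr) h) hgood0 ?_ ts
      ⟨le_rfl, hts⟩
    intro t ht hIoc
    have hK' : ∀ r ∈ Ioc t t₀, γ r ∈ K := fun r hr ↦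
      hmemK _ (hIoc r hr).1 (hKS r ⟨lt_of_le_of_lt ht.1 hr.1, hr.2⟩
        fun r' hr' ↦ hIoc r' ⟨lt_of_lt_of_le hr.1 hr'.1, hr'.2⟩)
    have htu : t ∈ u := hsub ⟨ht.1, ht.2.le⟩
    have hlim : Tendsto γ (𝓝[>] t) (𝓝 (γ t)) := (hcont t htu).continuousWithinAt.tendsto
    have hev : ∀ᶠ r in 𝓝[>] t, γ r ∈ K := by
      filter_upwards [Ioc_mem_nhdsGT ht.2] with r hr using hK' r hr
    exact hKgood _ (hKc.mem_of_tendsto hlim hev)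
  · -- Case B: the crossing is not earlier than `t₀`; continuous induction upwards on `[t₀, t*]`
    have hsub : Icc t₀ ts ⊆ u := huoc.out ht₀ htsu
    have hKS : ∀ r ∈ Ico t₀ ts, (∀ r' ∈ Icc t₀ r, γ r' ∈ (chartAt H p).source ∧
        ‖extChartAt I p (γ r') - x₀‖ < ρ) → ‖extChartAt I p (γ r) - x₀‖ ≤ 3 * ρ / 8 := by
      intro r hr hseg
      have hJ : ∀ r' ∈ Icc t₀ r, r' ∈ u := fun r' hr' ↦ hsub ⟨hr'.1, hr'.2.trans hr.2.le⟩
      have hrr : r ∈ Icc t₀ r := right_mem_Icc.mpr hr.1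
      obtain ⟨-, hest⟩ := cone_curve_estimate (-m) hc (ordConnected_Icc (a := t₀) (b := r))
        (σ' := fun r' ↦ eT.continuousLinearMapAt ℝ (γ r') (velocity I γ r'))
        (fun r' hr' ↦ hderiv r' (hJ r' hr') (hseg r' hr').1)
        (fun r' hr' ↦ hconeγ r' (hJ r' hr') (hseg r' hr').1 (hseg r' hr').2)
        (left_mem_Icc.mpr hr.1) hrr hr.1
      have hest' : c * ‖extChartAt I p (γ r) - extChartAt I p (γ t₀)‖ ≤
          m (extChartAt I p (γ t₀)) - m (extChartAt I p (γ r)) := by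
        have := hest
        simp only [comp_apply, neg_apply] at this
        linarith
      -- `γ r ∉ I⁺(Σ)` since `r < t*`
      have hrI : γ r ∉ g.chronologicalFuture τ Sig := fun hf ↦
        not_mem_chronologicalPast_of_mem_chronologicalFuture hn hSig hf
          (mem_chronologicalPast_of_lt huoc hftc (hJ r hrr) htsu hr.2 htsSig)
      have hosb2 := (hosb ρ hρρ₀ (γ r) (hseg r hrr).1 (hseg r hrr).2).2 hrI
      have hB : m (extChartAt I p (γ t₀) - x₀) ≤ ‖m‖ * ρ' := (le_abs_self _).trans hmt₀
      have e1 := m.map_sub (extChartAt I p (γ r)) x₀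
      have e2 := m.map_sub (extChartAt I p (γ t₀)) x₀
      have h2 : c * ‖extChartAt I p (γ r) - extChartAt I p (γ t₀)‖ ≤ c * (ρ / 4) := by
        linarith
      have h3 : ‖extChartAt I p (γ r) - extChartAt I p (γ t₀)‖ ≤ ρ / 4 :=
        le_of_mul_le_mul_left h2 hc
      calc ‖extChartAt I p (γ r) - x₀‖
          = ‖(extChartAt I p (γ r) - extChartAt I p (γ t₀)) + (extChartAt I p (γ t₀) - x₀)‖ := by
            abel_nf
        _ ≤ ‖extChartAt I p (γ r) - extChartAt I p (γ t₀)‖ + ‖extChartAt I p (γ t₀) - x₀‖ :=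
            norm_add_le _ _
        _ ≤ ρ / 4 + ρ' := add_le_add h3 hq0.2.le
        _ ≤ 3 * ρ / 8 := by linarith
    refine Icc_induction_up (P := fun r ↦ γ r ∈ (chartAt H p).source ∧
        ‖extChartAt I p (γ r) - x₀‖ < ρ) (fun r hr h ↦ hopen r (hsub hr) h) hgood0 ?_ ts
      ⟨hts, le_rfl⟩
    intro t ht hIco
    have hK' : ∀ r ∈ Ico t₀ t, γ r ∈ K := fun r hr ↦
      hmemK _ (hIco r hr).1 (hKS r ⟨hr.1, lt_of_lt_of_le hr.2 ht.2⟩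
        fun r' hr' ↦ hIco r' ⟨hr'.1, lt_of_le_of_lt hr'.2 hr.2⟩)
    have htu : t ∈ u := hsub ⟨ht.1.le, ht.2⟩
    have hlim : Tendsto γ (𝓝[<] t) (𝓝 (γ t)) := (hcont t htu).continuousWithinAt.tendsto
    have hev : ∀ᶠ r in 𝓝[<] t, γ r ∈ K := by
      filter_upwards [Ico_mem_nhdsLT ht.1] with r hr using hK' r hr
    exact hKgood _ (hKc.mem_of_tendsto hlim hev)

end Main

end SubdataDevelopmentsEmbed

end Summit.FinalStateConjecture.FinalStateConjecture.Theorems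

end
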